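import Literature.IUT.LogVolume.ThetaTowerUnramified
import HarnessLib

/-!
# Fields generated over `F_tpd` by torsion coordinates of the Legendre curve and prime-to-`v` roots of unity
# are unramified at the good places of `λ` (general form of [IUTchIV] Thm. 1.10 (D0) for the `F`-layer)

Mochizuki, *Inter-universal Teichmüller theory IV*, RIMS manuscript (Apr. 2020; = PRIMS **57** (2021)), Thm.
1.10 p. 22 ("`F` is obtained from `F_tpd` by adjoining `√−1`, together with the fields of definition of the
`(3·5)`-torsion points of a model `E_{F_tpd}` … determined by the Legendre form") and proof Step (iii) (D0)
p. 26 ("it follows immediately from Proposition 1.8, (vi), (vii) … that … the extension `K/F_tpd` is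
unramified over `v`"). Sequel of `ThetaTowerUnramified.lean`, which proves the case `F = F_tpd(√−1, E_λ[15])`
(`Cor22.ramificationIdx_thetaField_eq_one`). Here the SAME argument is recorded for an arbitrary finite Galois
`F ⊇ F_tpd` generated by elements each of which is either a root of unity of order invertible at `v` or a
coordinate of an `n`-torsion point of the Legendre curve `E_λ` with `n` invertible at `v` — so that it applies
verbatim to the variants of the field of the Θ-datum under discussion in the cell (`F_tpd(E_λ[4], E_λ[15])`,
the `F_mod`-Galois closure of print's `F`; any `F_tpd(μ_m, E_λ[n])`):

* `ramificationIdx_eq_one_of_adjoin_legendreTorsion` — **`e(w|v) = 1`** at every place `w` of such an `F` over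
  a good place `v ∤ 2` of `λ` with `n`, `m` invertible at `v` (Silverman VII.4.1: inertia fixes the torsion of
  the good-reduction Legendre equation; Neukirch II (7.13): and the prime-to-`v` roots of unity).

Theorems only; classical; TAKES NO SIDE on [IUTchIII] Cor. 3.12.
-/

noncomputable section

open scoped Classical

namespace Literature.IUT.LogVolume

namespace Cor22

open NumberField IsDedekindDomain Literature.NumberTheory.DiophantineGeometry.GenEll
open Literature.NumberTheory.EllipticCurves Literature.NumberTheory.GaloisRepresentations
open Literature.NumberTheory.NumberFields WeierstrassCurve IntermediateField Field

variable {P : NFPoint} (F : Type) [Field F] [NumberField F] [Algebra P.F F]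

/-- **A finite Galois extension of `F_tpd` generated by prime-to-`v` roots of unity and coordinates of
prime-to-`v` torsion points of the Legendre curve is unramified at every good place `v ∤ 2` of `λ`.** For
`λ ∈ U_X`, `F ⊇ F_tpd` finite Galois with `F = F_tpd(S)`, every `x ∈ S` either a root of unity of order `m`
with `m ∉ v` or a coordinate of a point `T ∈ E_λ(F)` with `n·T = O`, `n ∉ v`, and `v = w ∩ 𝓞_{F_tpd}` a place
with `2 ∉ v` at which `j(λ)` is integral: `e(w|v) = 1` (the Legendre equation has good reduction at `v`, so the
absolute inertia group at `v` fixes `E_λ[n]` pointwise, Silverman VII.4.1, and the roots of unity, Neukirch II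
(7.13); hence it fixes an isomorphic copy of `F` inside `F̄_tpd`). [cite: Mochizuki2012, IUTchIV Thm 1.10 proof Step (iii) (D0) p.26]
[cite: SilvermanAEC2009, Prop. VII.4.1(a)] [cite: NeukirchANT1999, Ch. II Prop. (7.13)] -/
theorem ramificationIdx_eq_one_of_adjoin_legendreTorsion (hU : P.InU) [IsGalois P.F F] {S : Set F}
    (hgen : IntermediateField.adjoin P.F S = ⊤) (w : HeightOneSpectrum (𝓞 F))
    (hS : ∀ x ∈ S, (∃ m : ℕ, ((m : ℕ) : 𝓞 P.F) ∉ (finBelow P.F F w).asIdeal ∧ x ^ m = 1) ∨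
      ∃ (n : ℕ) (T : (P.legendreCurve.baseChange F).toAffine.Point),
        ((n : ℕ) : 𝓞 P.F) ∉ (finBelow P.F F w).asIdeal ∧ (n : ℤ) • T = 0 ∧ x ∈ pointCoords T)
    (h2 : ((2 : ℕ) : 𝓞 P.F) ∉ (finBelow P.F F w).asIdeal) (hgood : finBelow P.F F w ∉ badPlaces P) :
    w.asIdeal.ramificationIdx (𝓞 P.F) = 1 := by
  haveI : P.legendreCurve.IsElliptic := P.legendreCurve_isElliptic_iff.2 hU
  set v := finBelow P.F F w with hvdef
  have hgoodred : P.legendreCurve.HasGoodReductionAt v := legendreCurve_hasGoodReductionAt hU v h2 hgood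
  -- `F ≃ F_tpd(φ S) ⊆ F̄_tpd`
  haveI : FiniteDimensional P.F F := Module.Finite.of_restrictScalars_finite ℚ P.F F
  set Ω := AlgebraicClosure P.F
  let φ : F →ₐ[P.F] Ω := IsAlgClosed.lift
  set L : IntermediateField P.F Ω := IntermediateField.adjoin P.F (φ '' S) with hLdef
  have hL : φ.fieldRange = L := by
    rw [AlgHom.fieldRange_eq_map, ← hgen, IntermediateField.adjoin_map]
  let e : F ≃ₐ[P.F] L :=
    (((IntermediateField.topEquiv (F := P.F) (E := F)).symm.trans (IntermediateField.equivMap ⊤ φ)).trans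
      (IntermediateField.equivOfEq (AlgHom.fieldRange_eq_map φ).symm)).trans
      (IntermediateField.equivOfEq hL)
  haveI : FiniteDimensional P.F L := LinearEquiv.finiteDimensional e.toLinearEquiv
  haveI : IsGalois P.F L := IsGalois.of_algEquiv e
  haveI : NumberField L := NumberField.of_module_finite P.F L
  -- the inertia group at `v` fixes `φ S`
  obtain ⟨𝔓, h𝔓⟩ := HeightOneSpectrum.primesAbove_nonempty v
  have hfixS : ∀ σ ∈ 𝔓.inertia (absoluteGaloisGroup P.F), ∀ s ∈ φ '' S, σ • s = s := by
    intro σ hσ s hs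
    obtain ⟨x, hx, rfl⟩ := hs
    rcases hS x hx with ⟨m, hm, hxm⟩ | ⟨n, T, hn, hT, hxT⟩
    · -- a root of unity of order prime to `v`
      have hxm' : (φ x) ^ m = 1 := by rw [← map_pow, hxm, map_one]
      exact smul_eq_of_mem_inertia_of_pow_eq_one v h𝔓 hσ hm hxm'
    · -- a coordinate of an `n`-torsion point: transport `T` to `E(F̄_tpd)` along `φ`
      let T' : geomPoints P.legendreCurve := Affine.Point.map (W' := P.legendreCurve.toAffine) φ T
      have hT' : (n : ℤ) • T' = 0 := by
        change (n : ℤ) • Affine.Point.map (W' := P.legendreCurve.toAffine) φ T = 0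
        rw [← map_zsmul, hT, map_zero]
      have hmem : T' ∈ geomTorsion P.legendreCurve (n : ℤ) := by
        change T' ∈ AddSubgroup.torsionBy (geomPoints P.legendreCurve) _
        rw [AddSubgroup.torsionBy, Submodule.mem_toAddSubgroup, Submodule.mem_torsionBy_iff]
        exact hT'
      have hfix : σ • T' = T' := by
        have := P.legendreCurve.smul_geomTorsion_eq_of_mem_inertia hgoodred (n := (n : ℤ))
          (by exact_mod_cast hn) h𝔓 hσ ⟨T', hmem⟩
        exact congrArg Subtype.val this
      refine forall_coords_of_smul_eq P σ T' hfix (φ x) ?_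
      rcases T with _ | ⟨a, b, hab⟩
      · simp [pointCoords] at hxT
      · change φ x ∈ pointCoords (Affine.Point.map (W' := P.legendreCurve.toAffine) φ
          (Affine.Point.some a b hab))
        rw [Affine.Point.map_some]
        simp only [pointCoords, Set.mem_insert_iff, Set.mem_singleton_iff] at hxT ⊢
        rcases hxT with rfl | rfl
        · exact Or.inl rfl
        · exact Or.inr rfl
  -- hence every prime of `𝓞 L` over `v` is unramified, in particular the one corresponding to `w`
  set Q : Ideal (𝓞 L) := w.asIdeal.map (RingOfIntegers.mapAlgEquiv e : 𝓞 F ≃ₐ[𝓞 P.F] 𝓞 L) with hQ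
  haveI : Q.IsPrime := isPrime_map_mapAlgEquiv e w
  haveI : Q.LiesOver v.asIdeal := liesOver_map_mapAlgEquiv e w _
  rw [← ramificationIdx_map_mapAlgEquiv e w]
  exact ramificationIdx_adjoin_eq_one_of_forall_smul_eq v (φ '' S) h𝔓 hfixS Q

end Cor22

end Literature.IUT.LogVolume

end
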